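import Summits.Ventures.YMGap.YM4Door.PathTransport

/-!
# YM4Door / DecimationPush — ★ BLOCK-OBSERVABLE IR IS INHERITED BY EXACT AXIAL DECIMATION, WITH A FIXED POINT OF CONSTANTS:
# the measure-level currency `PushClusters Φ`, the one-step lemma `pushClusters_axial_step` (`(A, m) ↦ (max A (32e^m), m)`), and
# ★★ `SU2.pushClusters_axialIter_bare`: the BARE strong-coupling theory at a certified door cell has block-observable IR at EVERY
# decimation depth on EVERY volume — unconditionally (the requests N-DEC / N-DEC′ of `DecimationFlow` are NOT needed for this)

HONEST FRAMING (cell `ym-beyond`, seat P2 «strong-coupling bridge», HUMAN RULING D-0035 / D-0037; g9 tree edition, 2026-08-25,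
≤ 400-line modules for the gate; memo `HOME/ROUTE-P2.md` v0.9 §4h / §2.9, spec `HOME/ROUTE-P2-LIFT-SPEC.md` v3).  LATTICE /
finite-torus bookkeeping only: nothing here is a continuum, spectral or Clay-sense statement; nothing here moves the weak-coupling
exit of Track A (uncertified); nothing here is a part of Bałaban's theorems; NO effective action is asserted to be at any door, and
the typed requests N-DEC `SU2.DoorDecimatesToBasin` / N-DEC′ `SU2.BasinInvariant` (`YM4Door/DecimationFlow.lean`) are neither used
nor proved — this module shows that they are UNNECESSARY for every OBSERVABLE-LEVEL consumer of block infrared behaviour (they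
remain the open ACTION-LEVEL statements: where the loads of the decimated effective action lie).  NO conjecture name, NO `sorry`,
NO axiom beyond the standard three; label K = kernel bookkeeping.

THE QUESTION (memo §4g → §4h).  `DecimationFlow` typed the strong-coupling mirror of N-NP as REQUESTS (a door cell decimates
into the Haar basin; the basin is decimation-invariant) and derived block-level IR at every depth FROM them
(`SU2.blockIRVia_axialIter_bare`).  For consumers that only integrate OBSERVABLES OF THE BLOCK FIELD (the shape in which the IR
leg is fed: covariances of bounded Lipschitz cylinder observables, `SU2.BlockObservablesCluster` of `BlockTransport`) the
action-level detour is unnecessary, because the renormalisation map always exists — and is exact — on MEASURES (Cardy 1996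
§3.1; whatever happens on the space of interactions, Friedli–Velenik 2017 §6.14.2).  THE ANSWER, typed and kernel-checked for
gauge-covariant axial decimation: ★ if the fine state's block observables via `Φ` cluster at `(A, m)` on the block torus
`b·S`, then its block observables via `(axial b S).link ∘ Φ` cluster at `(max A (32 e^m), m)` on `S` (`pushClusters_axial_step`,
every `b ≥ 2`): a coarse observable on `Δ` with loads `δ` is a fine observable on the straight paths of `Δ` with loads of total
`b·Σδ` (module `PathTransport`) and block separation `k + 1` is fine separation `≥ bk + 1`, so the hypothesis gives
`A·b²·(Σδ_g)(Σδ_f)·e^{−m(bk+1)}`, while oscillations give the trivial `8·(Σδ_g)(Σδ_f)` (`diam_F SU(2) = 2√2`); the two meet at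
the FIXED POINT OF CONSTANTS (`le_fixedPoint_of_bounds`): the fine bound is `≤ A·(Σδ_g)(Σδ_f)·e^{−m(k+1)}` as soon as
`b² ≤ e^{m(b−1)k}`, and otherwise `e^{mk} ≤ 4` (because `b² ≤ 4^{b−1}`), whence `8 ≤ 32·e^m·e^{−m(k+1)}`.  Since
`max (max A (32e^m)) (32e^m) = max A (32e^m)`, the lemma ITERATES along `axialIter b S K` with no further loss
(`pushClusters_axialIter_comp`, induction finest-level-first with the prefix map generalised), and depth `0` is the door theorem
pushed to observables by the exact push-forward (`GibbsFormVia.map_μW`, `pushClusters_of_blockIRVia`): ★★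
`SU2.pushClusters_axialIter_bare` — for every certified door cell `DoorCell β₀ ε₀ ε₁` (e.g. `doorCell_oneThird`, `β_W,eff ≤ 1/3`),
every bare `β ∈ [0, β₀]`, every factor `b ≥ 2`, every block volume `S ≥ 3` and EVERY depth `K`, the block observables of the
`K`-fold axially decimated `SU(2)` Wilson theory on `(ℤ/b^K S)^4` cluster at `(32·e^{1/100}, 1/100)` — the door's own constants
`(16·e^{1/50}, 1/100)` up to a factor `2·e^{−1/100}` in `A`, the SAME at all depths.

HONEST CAVEATS.  (1) The rate is per BLOCK unit at every depth (`e^{−k/100}` at block separation `k`, i.e. `1/(100·b^K)` in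
fine units): exact decimation LOSES NOTHING uniformly in depth and volume; no GAIN of the factor `b^K` is claimed.  (2) This is
block-OBSERVABLE IR (a property of the image MEASURE), not a statement about where the decimated effective ACTION lies: N-DEC /
N-DEC′ stay open (they are what a renormalisation-group proof of basin invariance would assert; the door-EDGE `1/3` versus
decimation-CORE `≈ 1/6` rows of memo §2.8 concern THEM) — for observable-level consumers the decimation axis of THE NUMBER
collapses to «edge `1/3` at all depths, constant `×2`» (memo §2.9).  (3) Nothing here touches the weak-coupling side: the input
at depth `0` is the certified strong-coupling door; the crossover NUMBER (memo §2) is unchanged.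

* §4 `PushClusters Φ β A m` (= `SU2.BlockObservablesCluster B` for `Φ = B.link`, definitional), `PushClusters.mono`;
  `GibbsFormVia.map_μW` (the fine Wilson probability measure pushed along `Φ` IS the Gibbs measure of the Gibbs form),
  ★ `pushClusters_of_blockIRVia` (action-level ⇒ observable-level IR); the trivial bound `abs_cov_comp_le_eight`.
* §5 `sq_le_four_pow` (`b² ≤ 4^{b−1}`), `le_fixedPoint_of_bounds`.  §6 `axial_link_eq_pathLink` (the axial blocking IS the
  straight-path blocking, `rfl`), ★ `pushClusters_axial_step`, `pushClusters_axialIter_comp`, `SU2.door_const_le_fixedPoint`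
  (`16e^{1/50} ≤ 32e^{1/100}`), ★★ `SU2.pushClusters_axialIter_bare(_oneThird)`, `SU2.blockObservablesCluster_axial_bare`.

References: J. Cardy, Scaling and Renormalization in Statistical Physics, CUP 1996, §3.1 (blocking leaves the law of block
observables invariant); S. Friedli, Y. Velenik, Statistical Mechanics of Lattice Systems, CUP 2017, §6.14.2 (the renormalisation
map exists on measures, not in general on interactions: Griffiths–Pearce 1979, Israel 1981, van Enter–Fernández–Sokal, J. Stat.
Phys. 72 (1993) 879–1167); the fixed point of constants and the gauge-covariant (path-transporter) instance are this module's
bookkeeping.  §4–§6 of the one text whose §1–§3 are `YM4Door/PathTransport.lean`.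
-/
noncomputable section

open MeasureTheory ProbabilityTheory Finset Function Metric
open scoped Matrix.Norms.Frobenius
open Literature.Probability.LatticeModels Literature.Probability.LatticeModels.DobrushinMetric
open Literature.MathematicalPhysics.QuantumLattice hiding torusNorm configShift
open Literature.MathematicalPhysics.QuantumFieldTheory hiding ZdEdge
open Summit.Ventures.YMGap.RobustBall

namespace Summit.Ventures.YMGap.YM4Door

open scoped ENNReal

/-! ## §4  `PushClusters Φ`: block-observable IR via a link map — the measure-level currency -/

section Push

variable {n S : ℕ} [NeZero n] [NeZero S]

/-- **IR FOR BLOCK OBSERVABLES VIA THE LINK MAP `Φ`** (fine torus `n` → block torus `S`): bounded measurable Lipschitz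
cylinder observables OF THE BLOCK FIELD `Φ U`, supported on block-link sets at block sup-distance `≥ k`, have fine-state
covariance `≤ A·(Σδ_g)(Σδ_f)·e^{−m k}`.  For a tree blocking this IS `SU2.BlockObservablesCluster B`
(`SU2.blockObservablesCluster_iff_pushClusters`); it is implied by the action-level `BlockIRVia Φ` (`pushClusters_of_blockIRVia`)
and — the point of this module — it is preserved by exact axial decimation with a fixed point of constants (`pushClusters_axial_step`). -/
@[folklore] def PushClusters (Φ : GaugeConfig 4 n (SUN 2) → GaugeConfig 4 S (SUN 2)) (β A m : ℝ) : Prop :=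
  ∀ (f g : GaugeConfig 4 S (SUN 2) → ℝ) (Δf Δg : Finset (Edge 4 S)) (δf δg : Edge 4 S → ℝ) (k : ℕ),
    Measurable f → Measurable g → DependsOn f (↑Δf : Set (Edge 4 S)) →
    DependsOn g (↑Δg : Set (Edge 4 S)) → (∃ M, ∀ U, |f U| ≤ M) → (∃ M, ∀ U, |g U| ≤ M) →
    IsLipBound suFrobDist f δf → IsLipBound suFrobDist g δg →
    (∀ x ∈ Δf, ∀ y ∈ Δg, k ≤ torusNorm (x.1 - y.1)) →
      |cov[fun U => f (Φ U), fun U => g (Φ U); SU2.μW β n]| ≤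
        A * (∑ y ∈ Δg, δg y) * (∑ x ∈ Δf, δf x) * Real.exp (-m * k)

/-- For a tree blocking, `PushClusters B.link` IS `SU2.BlockObservablesCluster B` (definitional). -/
theorem SU2.blockObservablesCluster_iff_pushClusters {b : ℕ} [NeZero b] (B : GaugeBlockAveraging 4 (SUN 2) b S)
    (β A m : ℝ) : SU2.BlockObservablesCluster B β A m ↔ PushClusters B.link β A m :=
  Iff.rfl

omit [NeZero S] in
/-- The constant may be enlarged. -/
theorem PushClusters.mono {Φ : GaugeConfig 4 n (SUN 2) → GaugeConfig 4 S (SUN 2)} {β A A' m : ℝ}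
    (h : PushClusters Φ β A m) (hA : A ≤ A') : PushClusters Φ β A' m := by
  intro f g Δf Δg δf δg k hf hg hfd hgd hfb hgb hfl hgl hsep
  refine (h f g Δf Δg δf δg k hf hg hfd hgd hfb hgb hfl hgl hsep).trans ?_
  have h1 : 0 ≤ ∑ y ∈ Δg, δg y := Finset.sum_nonneg fun y _ => hgl.nonneg y
  have h2 : 0 ≤ ∑ x ∈ Δf, δf x := Finset.sum_nonneg fun x _ => hfl.nonneg x
  exact mul_le_mul_of_nonneg_right (mul_le_mul_of_nonneg_right (mul_le_mul_of_nonneg_right hA h1) h2)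
    (Real.exp_pos _).le

/-- The fine Wilson WEIGHT pushed along `Φ` is the weight of the Gibbs form. -/
theorem GibbsFormVia.map_wilsonWeight {Φ : GaugeConfig 4 n (SUN 2) → GaugeConfig 4 S (SUN 2)} {β : ℝ}
    {x : BalabanEffectiveAction 4 S (SUN 2) 1} (hx : GibbsFormVia Φ β x) :
    (wilsonWeight (d := 4) (L := n) SU2.ρ2 β).map Φ = x.terms.weight SU2.ρ2 x.β := by
  have h : ((torusLinkHaar 4 (SUN 2) n).withDensity (perturbedWilsonDensity SU2.ρ2 β 0)).map Φ =
      (torusLinkHaar 4 (SUN 2) S).withDensity (x.density SU2.ρ2) := hx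
  rw [withDensity_perturbedWilsonDensity_zero, BalabanEffectiveAction.density_eq_perturbedWilsonDensity] at h
  exact h.trans (withDensity_perturbedWilsonDensity_total SU2.ρ2 x.β x.terms)

/-- Pushing forward loses no mass: the Gibbs form's partition function is the fine Wilson partition function. -/
theorem GibbsFormVia.partitionFunction_eq {Φ : GaugeConfig 4 n (SUN 2) → GaugeConfig 4 S (SUN 2)} (hΦ : Measurable Φ)
    {β : ℝ} {x : BalabanEffectiveAction 4 S (SUN 2) 1} (hx : GibbsFormVia Φ β x) :
    x.terms.partitionFunction SU2.ρ2 x.β = partitionFunction (d := 4) (L := n) SU2.ρ2 β := by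
  rw [QuasiLocalGaugePerturbation.partitionFunction, ← hx.map_wilsonWeight, Measure.map_apply hΦ MeasurableSet.univ,
    Set.preimage_univ]
  rfl

/-- **The fine Wilson PROBABILITY measure pushed along `Φ` is the Gibbs measure of the Gibbs form.** -/
theorem GibbsFormVia.map_μW {Φ : GaugeConfig 4 n (SUN 2) → GaugeConfig 4 S (SUN 2)} (hΦ : Measurable Φ) {β : ℝ}
    {x : BalabanEffectiveAction 4 S (SUN 2) 1} (hx : GibbsFormVia Φ β x) :
    (SU2.μW β n).map Φ = x.terms.perturbedMeasure SU2.ρ2 x.β := by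
  show (wilsonMeasure (d := 4) (L := n) SU2.ρ2 β).map Φ = _
  rw [wilsonMeasure, Measure.map_smul, hx.map_wilsonWeight, QuasiLocalGaugePerturbation.perturbedMeasure,
    hx.partitionFunction_eq hΦ]

/-- **Block observables through `Φ`**: `cov_{β,n}[f∘Φ, g∘Φ] = cov_x[f, g]` for the Gibbs form `x` via `Φ`. -/
theorem GibbsFormVia.covariance_comp {Φ : GaugeConfig 4 n (SUN 2) → GaugeConfig 4 S (SUN 2)} (hΦ : Measurable Φ)
    {β : ℝ} {x : BalabanEffectiveAction 4 S (SUN 2) 1} (hx : GibbsFormVia Φ β x) {f g : GaugeConfig 4 S (SUN 2) → ℝ}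
    (hf : Measurable f) (hg : Measurable g) :
    cov[fun U => f (Φ U), fun U => g (Φ U); SU2.μW β n] = cov[f, g; x.terms.perturbedMeasure SU2.ρ2 x.β] := by
  rw [← hx.map_μW hΦ]
  exact (covariance_map_fun hf.aestronglyMeasurable hg.aestronglyMeasurable hΦ.aemeasurable).symm

/-- ★ **Action-level IR ⇒ observable-level IR**: `BlockIRVia Φ β A m ⇒ PushClusters Φ β A m` (exact push-forward). -/
theorem pushClusters_of_blockIRVia {Φ : GaugeConfig 4 n (SUN 2) → GaugeConfig 4 S (SUN 2)} (hΦ : Measurable Φ)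
    {β A m : ℝ} (h : BlockIRVia Φ β A m) : PushClusters Φ β A m := by
  obtain ⟨x, hx, hcl⟩ := h
  intro f g Δf Δg δf δg k hf hg hfd hgd hfb hgb hfl hgl hsep
  rw [GibbsFormVia.covariance_comp hΦ hx hf hg]
  exact hcl f g Δf Δg δf δg k hf hg hfd hgd hfb hgb hfl hgl hsep

omit [NeZero S] in
/-- **The trivial bound** — any link map, any separation: `|cov[f∘Φ, g∘Φ]| ≤ 8·(Σδ_g)(Σδ_f)` (oscillation of a Lipschitz
cylinder observable `≤ diam_F SU(2) · Σδ = 2√2·Σδ`, `abs_covariance_le_of_osc`). -/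
theorem abs_cov_comp_le_eight {Φ : GaugeConfig 4 n (SUN 2) → GaugeConfig 4 S (SUN 2)} (hΦ : Measurable Φ) (β : ℝ)
    {f g : GaugeConfig 4 S (SUN 2) → ℝ} {Δf Δg : Finset (Edge 4 S)} {δf δg : Edge 4 S → ℝ}
    (hf : Measurable f) (hg : Measurable g) (hfd : DependsOn f (↑Δf : Set (Edge 4 S)))
    (hgd : DependsOn g (↑Δg : Set (Edge 4 S))) (hfb : ∃ M, ∀ U, |f U| ≤ M) (hgb : ∃ M, ∀ U, |g U| ≤ M)
    (hfl : IsLipBound suFrobDist f δf) (hgl : IsLipBound suFrobDist g δg) :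
    |cov[fun U => f (Φ U), fun U => g (Φ U); SU2.μW β n]| ≤ 8 * (∑ y ∈ Δg, δg y) * (∑ x ∈ Δf, δf x) := by
  haveI := isProbabilityMeasure_wilsonMeasure (d := 4) (L := n) SU2.ρ2 SU2.continuous_ρ2 β
  have hdiam : ∀ a c : SUN 2, suFrobDist a c ≤ 2 * Real.sqrt 2 := fun a c => by exact_mod_cast suFrobDist_le a c
  have hof : ∀ U V : GaugeConfig 4 n (SUN 2), |f (Φ U) - f (Φ V)| ≤ 2 * Real.sqrt 2 * ∑ x ∈ Δf, δf x :=
    fun U V => abs_sub_le_mul_sum_of_dependsOn hdiam hfd hfl _ _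
  have hog : ∀ U V : GaugeConfig 4 n (SUN 2), |g (Φ U) - g (Φ V)| ≤ 2 * Real.sqrt 2 * ∑ y ∈ Δg, δg y :=
    fun U V => abs_sub_le_mul_sum_of_dependsOn hdiam hgd hgl _ _
  obtain ⟨Mf, hMf⟩ := hfb
  obtain ⟨Mg, hMg⟩ := hgb
  refine (abs_covariance_le_of_osc (μ := SU2.μW β n) (u := fun U => f (Φ U)) (v := fun U => g (Φ U)) (hf.comp hΦ)
    (hg.comp hΦ) ⟨Mf, fun U => hMf _⟩ ⟨Mg, fun U => hMg _⟩ hof hog).trans (le_of_eq ?_)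
  have h2 : Real.sqrt 2 * Real.sqrt 2 = 2 := Real.mul_self_sqrt (by norm_num)
  linear_combination (4 * (∑ y ∈ Δg, δg y) * (∑ x ∈ Δf, δf x)) * h2

end Push

/-! ## §5  The fixed point of constants -/

section Numeric

/-- `b² ≤ 4^{b−1}` for `b ≥ 2`. -/
theorem sq_le_four_pow {b : ℕ} (hb : 2 ≤ b) : b ^ 2 ≤ 4 ^ (b - 1) := by
  induction b, hb using Nat.le_induction with
  | base => norm_num
  | succ b hb ih =>
      have h1 : (b + 1) ^ 2 ≤ 4 * b ^ 2 := by nlinarith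
      calc (b + 1) ^ 2 ≤ 4 * b ^ 2 := h1
        _ ≤ 4 * 4 ^ (b - 1) := Nat.mul_le_mul_left 4 ih
        _ = 4 ^ (b + 1 - 1) := by
            rw [show b + 1 - 1 = b - 1 + 1 by omega, pow_succ]
            ring

/-- **The fixed point of constants.**  For `b ≥ 2`, `A, P ≥ 0` (and any real rate `m`): a quantity bounded by the trivial `8·P` and, at
block separation `k + 1`, by the fine bound `A·b²·P·e^{−m(bk+1)}` is `≤ max A (32e^m) · P · e^{−m(k+1)}` — the fine bound wins
as soon as `b² ≤ e^{m(b−1)k}`, and otherwise `e^{mk} ≤ 4` (`sq_le_four_pow`) so the trivial bound is `≤ 32e^m·P·e^{−m(k+1)}`. -/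
theorem le_fixedPoint_of_bounds {b : ℕ} (hb : 2 ≤ b) {m A P c : ℝ} (hA : 0 ≤ A) (hP : 0 ≤ P) (k : ℕ)
    (h8 : c ≤ 8 * P) (hfine : c ≤ A * (b : ℝ) ^ 2 * P * Real.exp (-m * ((b * k + 1 : ℕ) : ℝ))) :
    c ≤ max A (32 * Real.exp m) * P * Real.exp (-m * ((k + 1 : ℕ) : ℝ)) := by
  have hE := Real.exp_pos (-m * ((k + 1 : ℕ) : ℝ))
  rcases le_or_gt ((b : ℝ) ^ 2) (Real.exp (m * ((b : ℝ) - 1) * k)) with hcase | hcase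
  · refine hfine.trans ?_
    have hexp : (b : ℝ) ^ 2 * Real.exp (-m * ((b * k + 1 : ℕ) : ℝ)) ≤ Real.exp (-m * ((k + 1 : ℕ) : ℝ)) := by
      have hsplit : Real.exp (-m * ((k + 1 : ℕ) : ℝ)) =
          Real.exp (m * ((b : ℝ) - 1) * k) * Real.exp (-m * ((b * k + 1 : ℕ) : ℝ)) := by
        rw [← Real.exp_add]; congr 1; push_cast; ring
      rw [hsplit]
      exact mul_le_mul_of_nonneg_right hcase (Real.exp_pos _).le
    calc A * (b : ℝ) ^ 2 * P * Real.exp (-m * ((b * k + 1 : ℕ) : ℝ))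
        = A * P * ((b : ℝ) ^ 2 * Real.exp (-m * ((b * k + 1 : ℕ) : ℝ))) := by ring
      _ ≤ A * P * Real.exp (-m * ((k + 1 : ℕ) : ℝ)) := mul_le_mul_of_nonneg_left hexp (mul_nonneg hA hP)
      _ = A * (P * Real.exp (-m * ((k + 1 : ℕ) : ℝ))) := by ring
      _ ≤ max A (32 * Real.exp m) * (P * Real.exp (-m * ((k + 1 : ℕ) : ℝ))) :=
          mul_le_mul_of_nonneg_right (le_max_left _ _) (mul_nonneg hP hE.le)
      _ = max A (32 * Real.exp m) * P * Real.exp (-m * ((k + 1 : ℕ) : ℝ)) := by ring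
  · have hx4 : Real.exp (m * k) ≤ 4 := le_of_not_gt fun hlt => by
      have hpow : (4 : ℝ) ^ (b - 1) < Real.exp (m * k) ^ (b - 1) := pow_lt_pow_left₀ hlt (by norm_num) (by omega : b - 1 ≠ 0)
      have hsq : ((b ^ 2 : ℕ) : ℝ) ≤ ((4 ^ (b - 1) : ℕ) : ℝ) := by exact_mod_cast sq_le_four_pow hb
      push_cast at hsq
      have hexp : Real.exp (m * k) ^ (b - 1) = Real.exp (m * ((b : ℝ) - 1) * k) := by
        rw [← Real.exp_nat_mul]; congr 1; push_cast [Nat.cast_sub (by omega : 1 ≤ b)]; ring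
      rw [hexp] at hpow
      linarith
    have hinv : Real.exp (m * k) * Real.exp (-(m * k)) = 1 := by rw [← Real.exp_add, add_neg_cancel, Real.exp_zero]
    have hq : 1 ≤ 4 * Real.exp (-(m * k)) := by
      have := mul_le_mul_of_nonneg_right hx4 (Real.exp_pos (-(m * k))).le
      linarith
    have hsplit : Real.exp m * Real.exp (-m * ((k + 1 : ℕ) : ℝ)) = Real.exp (-(m * k)) := by
      rw [← Real.exp_add]; congr 1; push_cast; ring
    refine h8.trans ?_
    calc 8 * P = 8 * P * 1 := by ring
      _ ≤ 8 * P * (4 * Real.exp (-(m * k))) := mul_le_mul_of_nonneg_left hq (by positivity)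
      _ = 32 * Real.exp m * (P * Real.exp (-m * ((k + 1 : ℕ) : ℝ))) := by rw [← hsplit]; ring
      _ ≤ max A (32 * Real.exp m) * (P * Real.exp (-m * ((k + 1 : ℕ) : ℝ))) :=
          mul_le_mul_of_nonneg_right (le_max_right _ _) (mul_nonneg hP hE.le)
      _ = max A (32 * Real.exp m) * P * Real.exp (-m * ((k + 1 : ℕ) : ℝ)) := by ring

end Numeric

/-! ## §6  ★ The one-step lemma (fixed point of constants) and ★ the bare theory at every decimation depth -/

section Step

variable {N S : ℕ} [NeZero N] [NeZero S]

/-- The straight path of the axial blocking starts at the representative `b·y` of the block link `(y, μ)` … -/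
def axialCorner (b S : ℕ) (ℓ : Edge 4 S) : Site 4 (b * S) := torusBlockCorner b S ℓ.1

/-- … and takes `b` steps in direction `μ`. -/
def axialPath (b : ℕ) {S : ℕ} (ℓ : Edge 4 S) : List (Fin 4) := List.replicate b ℓ.2

/-- The axial blocking IS the path blocking of the straight paths (definitional). -/
theorem axial_link_eq_pathLink (b : ℕ) :
    (GaugeBlockAveraging.axial (d := 4) (G := SUN 2) b S).link = pathLink (axialCorner b S) (axialPath b) :=
  rfl

/-- ★ **THE ONE-STEP LEMMA.**  Block-observable IR via `Φ` onto the torus `b·S` at `(A, m)` ⇒ block-observable IR via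
`(axial b S).link ∘ Φ` onto `S` at `(max A (32e^m), m)`, for every `b ≥ 2`: an observable of the decimated field on `Δ` with
loads `δ` is an observable of the field on `b·S` on the straight paths of `Δ` with loads `pathLoad` of total `b·Σδ`
(`isLipBound_comp_pathLink`, `sum_pathLoad_le`); block separation `k + 1` is fine separation `≥ bk + 1`
(`sep_of_mem_pathEdges_axial`); and the two available bounds meet at the fixed point (`le_fixedPoint_of_bounds`). -/
theorem pushClusters_axial_step {b : ℕ} [NeZero b] (hb : 2 ≤ b)
    {Φ : GaugeConfig 4 N (SUN 2) → GaugeConfig 4 (b * S) (SUN 2)} (hΦ : Measurable Φ) {β A m : ℝ} (hA : 0 ≤ A)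
    (hm : 0 ≤ m) (h : PushClusters Φ β A m) :
    PushClusters ((GaugeBlockAveraging.axial (d := 4) (G := SUN 2) b S).link ∘ Φ) β (max A (32 * Real.exp m)) m := by
  rw [axial_link_eq_pathLink]
  intro F G ΔF ΔG δF δG k hFm hGm hFd hGd hFb hGb hFl hGl hsep
  have hpm : Measurable (pathLink (N := 2) (axialCorner b S) (axialPath b)) := measurable_pathLink _ _
  have hsumG : 0 ≤ ∑ y ∈ ΔG, δG y := Finset.sum_nonneg fun y _ => hGl.nonneg y
  have hsumF : 0 ≤ ∑ x ∈ ΔF, δF x := Finset.sum_nonneg fun x _ => hFl.nonneg x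
  -- (T) the trivial bound, in the COARSE loads
  have h8 : |cov[fun U => F ((pathLink (axialCorner b S) (axialPath b) ∘ Φ) U),
      fun U => G ((pathLink (axialCorner b S) (axialPath b) ∘ Φ) U); SU2.μW β N]| ≤
      8 * (∑ y ∈ ΔG, δG y) * (∑ x ∈ ΔF, δF x) :=
    abs_cov_comp_le_eight (hpm.comp hΦ) β hFm hGm hFd hGd hFb hGb hFl hGl
  cases k with
  | zero =>
      refine h8.trans ?_
      rw [Nat.cast_zero, mul_zero, Real.exp_zero, mul_one]
      have h32 : (8 : ℝ) ≤ max A (32 * Real.exp m) :=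
        le_trans (by linarith [Real.add_one_le_exp m]) (le_max_right _ _)
      exact mul_le_mul_of_nonneg_right (mul_le_mul_of_nonneg_right h32 hsumG) hsumF
  | succ k =>
      -- (F) the fine bound, for the PULLED-BACK observables (paths of length `b`, loads `pathLoad`, separation `bk+1`)
      obtain ⟨MF, hMF⟩ := hFb
      obtain ⟨MG, hMG⟩ := hGb
      have hsep' : ∀ e ∈ pathSupport (axialCorner b S) (axialPath b) ΔF, ∀ e' ∈ pathSupport (axialCorner b S) (axialPath b) ΔG,
          b * k + 1 ≤ torusNorm (e.1 - e'.1) := by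
        intro e he e' he'
        obtain ⟨x, hx, hex⟩ := Finset.mem_biUnion.1 he
        obtain ⟨y, hy, hey⟩ := Finset.mem_biUnion.1 he'
        exact sep_of_mem_pathEdges_axial (hsep x hx y hy) (List.mem_toFinset.1 hex) (List.mem_toFinset.1 hey)
      have hfine : |cov[fun U => F ((pathLink (axialCorner b S) (axialPath b) ∘ Φ) U),
          fun U => G ((pathLink (axialCorner b S) (axialPath b) ∘ Φ) U); SU2.μW β N]| ≤
          A * (∑ e ∈ pathSupport (axialCorner b S) (axialPath b) ΔG, pathLoad (axialCorner b S) (axialPath b) ΔG δG e) *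
            (∑ e ∈ pathSupport (axialCorner b S) (axialPath b) ΔF, pathLoad (axialCorner b S) (axialPath b) ΔF δF e) *
            Real.exp (-m * ((b * k + 1 : ℕ) : ℝ)) :=
        h (fun V => F (pathLink (axialCorner b S) (axialPath b) V)) (fun V => G (pathLink (axialCorner b S) (axialPath b) V))
          _ _ _ _ (b * k + 1) (hFm.comp hpm) (hGm.comp hpm) (dependsOn_comp_pathLink hFd) (dependsOn_comp_pathLink hGd)
          ⟨MF, fun V => hMF _⟩ ⟨MG, fun V => hMG _⟩ (isLipBound_comp_pathLink hFd hFl)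
          (isLipBound_comp_pathLink hGd hGl) hsep'
      have hSG : ∑ e ∈ pathSupport (axialCorner b S) (axialPath b) ΔG, pathLoad (axialCorner b S) (axialPath b) ΔG δG e ≤
          b * ∑ y ∈ ΔG, δG y := by
        refine (sum_pathLoad_le hGl.nonneg).trans (le_of_eq ?_)
        simp only [axialPath, List.length_replicate]
        rw [Finset.mul_sum]
        exact Finset.sum_congr rfl fun y _ => by ring
      have hSF : ∑ e ∈ pathSupport (axialCorner b S) (axialPath b) ΔF, pathLoad (axialCorner b S) (axialPath b) ΔF δF e ≤
          b * ∑ x ∈ ΔF, δF x := by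
        refine (sum_pathLoad_le hFl.nonneg).trans (le_of_eq ?_)
        simp only [axialPath, List.length_replicate]
        rw [Finset.mul_sum]
        exact Finset.sum_congr rfl fun x _ => by ring
      have hSF0 : 0 ≤ ∑ e ∈ pathSupport (axialCorner b S) (axialPath b) ΔF,
          pathLoad (axialCorner b S) (axialPath b) ΔF δF e :=
        Finset.sum_nonneg fun e _ => Finset.sum_nonneg fun ℓ _ => mul_nonneg (hFl.nonneg ℓ) (Nat.cast_nonneg _)
      have hfine' : |cov[fun U => F ((pathLink (axialCorner b S) (axialPath b) ∘ Φ) U),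
          fun U => G ((pathLink (axialCorner b S) (axialPath b) ∘ Φ) U); SU2.μW β N]| ≤
          A * (b : ℝ) ^ 2 * ((∑ y ∈ ΔG, δG y) * (∑ x ∈ ΔF, δF x)) * Real.exp (-m * ((b * k + 1 : ℕ) : ℝ)) := by
        refine hfine.trans ?_
        have h1 := mul_le_mul_of_nonneg_left hSG hA
        have h2 := mul_le_mul h1 hSF hSF0 (mul_nonneg hA (mul_nonneg (Nat.cast_nonneg b) hsumG))
        have h3 := mul_le_mul_of_nonneg_right h2 (Real.exp_pos (-m * ((b * k + 1 : ℕ) : ℝ))).le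
        refine h3.trans (le_of_eq ?_)
        ring
      have h8' : |cov[fun U => F ((pathLink (axialCorner b S) (axialPath b) ∘ Φ) U),
          fun U => G ((pathLink (axialCorner b S) (axialPath b) ∘ Φ) U); SU2.μW β N]| ≤
          8 * ((∑ y ∈ ΔG, δG y) * (∑ x ∈ ΔF, δF x)) := h8.trans (le_of_eq (by ring))
      exact (le_fixedPoint_of_bounds hb hA (mul_nonneg hsumG hsumF) k h8' hfine').trans (le_of_eq (by ring))

/-- ★ **ALL DEPTHS** (induction along `axialIter`, finest level first, the prefix `Φ` generalised).  `(max A (32e^m), m)` is a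
fixed point of the one-step map of constants, so block-observable IR via `Φ` onto the torus `b^K·S` at `(A, m)` propagates
through the `K` decimations down to `S` at `(max A (32e^m), m)` — for EVERY `K`, with no further loss. -/
theorem pushClusters_axialIter_comp {b : ℕ} [NeZero b] (hb : 2 ≤ b) {β m : ℝ} (hm : 0 ≤ m) :
    ∀ (K : ℕ) {A : ℝ}, 0 ≤ A →
      ∀ (Φ : GaugeConfig 4 N (SUN 2) → GaugeConfig 4 (iterSize b S K) (SUN 2)), Measurable Φ →
        PushClusters Φ β A m → PushClusters (axialIter b S K ∘ Φ) β (max A (32 * Real.exp m)) m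
  | 0, _, _, _, _, h => h.mono (le_max_left _ _)
  | K + 1, A, hA, Φ, hΦ, h => by
      have h1 := pushClusters_axial_step (S := iterSize b S K) hb hΦ hA hm h
      have h2 := pushClusters_axialIter_comp hb hm K (hA.trans (le_max_left A (32 * Real.exp m)))
        ((GaugeBlockAveraging.axial (d := 4) (G := SUN 2) b (iterSize b S K)).link ∘ Φ)
        ((GaugeBlockAveraging.axial (d := 4) (G := SUN 2) b (iterSize b S K)).measurable_link.comp hΦ) h1
      rw [max_assoc, max_self] at h2
      exact h2

end Step

namespace SU2

variable {S : ℕ} [NeZero S]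

/-- `e^{1/100} ≤ 2` (crude). -/
theorem exp_hundredth_le_two : Real.exp (1 / 100) ≤ 2 := by
  have h := Real.exp_bound_div_one_sub_of_interval (x := 1 / 100) (by norm_num) (by norm_num)
  exact h.trans (by norm_num)

/-- The door's constant is below the fixed point: `16·e^{1/50} ≤ 32·e^{1/100}`. -/
theorem door_const_le_fixedPoint : 16 * Real.exp (1 / 50) ≤ 32 * Real.exp (1 / 100) := by
  have h : Real.exp (1 / 50) = Real.exp (1 / 100) * Real.exp (1 / 100) := by
    rw [← Real.exp_add]; norm_num
  rw [h]
  nlinarith [exp_hundredth_le_two, Real.exp_pos (1 / 100)]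

/-- ★★ **THE BARE STRONG-COUPLING THEORY HAS BLOCK-OBSERVABLE IR AT EVERY DECIMATION DEPTH — UNCONDITIONALLY.**  For every
certified door cell `(β₀; ε₀, ε₁)` (`DoorCell`, e.g. `doorCell_oneThird`: `β_W,eff ≤ 1/3`), every bare coupling `β ∈ [0, β₀]`,
every factor `b ≥ 2`, every block volume `S ≥ 3` and EVERY depth `K`: bounded Lipschitz cylinder observables of the `K`-fold
axially decimated field of the `SU(2)` Wilson theory on the torus `b^K·S` cluster at `(32·e^{1/100}, 1/100)` per block.
No request (N-DEC / N-DEC′ of `DecimationFlow` are NOT used): depth `0` is the door theorem pushed to observables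
(`pushClusters_of_blockIRVia`), and every further depth is `pushClusters_axial_step` at its fixed point. -/
theorem pushClusters_axialIter_bare {b : ℕ} [NeZero b] (hb : 2 ≤ b) (hS : 3 ≤ S) {β₀ ε₀ ε₁ : ℝ}
    (hcell : DoorCell β₀ ε₀ ε₁) (hε₀ : 0 ≤ ε₀) (hε₁ : 0 ≤ ε₁) {β : ℝ} (hβ0 : 0 ≤ β) (hβ : β ≤ β₀) (K : ℕ) :
    PushClusters (axialIter b S K) β (32 * Real.exp (1 / 100)) (1 / 100) := by
  have hL : 3 ≤ iterSize b S K := hS.trans (le_iterSize b S K)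
  have hd : AtDoorCell (BalabanEffectiveAction.wilsonAt (d := 4) (S := iterSize b S K) (G := SUN 2) (c := 1) β)
      (1 / 100) β₀ ε₀ ε₁ :=
    ⟨hβ0, hβ, le_rfl, zero_mem_clusterDomain hε₀ hε₁⟩
  have h0 : PushClusters (id : GaugeConfig 4 (iterSize b S K) (SUN 2) → GaugeConfig 4 (iterSize b S K) (SUN 2)) β
      (16 * Real.exp (1 / 50)) (1 / 100) :=
    pushClusters_of_blockIRVia measurable_id
      ((gibbsFormVia_id_wilsonAt β).blockIRVia (clustersWith_of_atDoorCell hL hcell _ hd))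
  have h1 := pushClusters_axialIter_comp (N := iterSize b S K) (S := S) hb (by norm_num : (0 : ℝ) ≤ 1 / 100) K
    (by positivity : (0 : ℝ) ≤ 16 * Real.exp (1 / 50)) id measurable_id h0
  rw [max_eq_right door_const_le_fixedPoint] at h1
  exact h1

/-- At the cell `β_W,eff ≤ 1/3` (`doorCell_oneThird`): every bare `β ∈ [0, 1/6]` (tree units), every `b ≥ 2`, `S ≥ 3`, `K`. -/
theorem pushClusters_axialIter_bare_oneThird {b : ℕ} [NeZero b] (hb : 2 ≤ b) (hS : 3 ≤ S) {β : ℝ} (hβ0 : 0 ≤ β)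
    (hβ : β ≤ 1 / 6) (K : ℕ) : PushClusters (axialIter b S K) β (32 * Real.exp (1 / 100)) (1 / 100) :=
  pushClusters_axialIter_bare hb hS doorCell_oneThird (by norm_num) (by norm_num) hβ0 hβ K

/-- **COROLLARY (depth 1, in g4's currency)**: the block observables of ONE axial decimation of the bare door theory cluster —
`SU2.BlockObservablesCluster (axial b S) β (32·e^{1/100}) (1/100)` — with NO effective action located anywhere. -/
theorem blockObservablesCluster_axial_bare {b : ℕ} [NeZero b] (hb : 2 ≤ b) (hS : 3 ≤ S) {β₀ ε₀ ε₁ : ℝ}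
    (hcell : DoorCell β₀ ε₀ ε₁) (hε₀ : 0 ≤ ε₀) (hε₁ : 0 ≤ ε₁) {β : ℝ} (hβ0 : 0 ≤ β) (hβ : β ≤ β₀) :
    BlockObservablesCluster (GaugeBlockAveraging.axial (d := 4) (G := SUN 2) b S) β (32 * Real.exp (1 / 100)) (1 / 100) :=
  (blockObservablesCluster_iff_pushClusters _ _ _ _).2 (pushClusters_axialIter_bare hb hS hcell hε₀ hε₁ hβ0 hβ 1)

end SU2

end Summit.Ventures.YMGap.YM4Door

end
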